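import Literature.NumberTheory.GaloisRepresentations.HerbrandFunction
import Literature.NumberTheory.GaloisRepresentations.CubicEisensteinRamificationProofs
import Literature.NumberTheory.GaloisRepresentations.TameInertiaProofs
import Literature.NumberTheory.GaloisRepresentations.RamificationFiltrationTowerProofs
import Literature.NumberTheory.GaloisRepresentations.RamificationFiltrationProofs
import Literature.NumberTheory.GaloisRepresentations.RamificationFiltrationHerbrandQuotientProofs
import Literature.NumberTheory.GaloisRepresentations.SerreWeightExistenceProofs
import Literature.NumberTheory.GaloisRepresentations.ArtinRestriction
import Literature.NumberTheory.GaloisRepresentations.ArtinConductorLocalProofs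
import Literature.NumberTheory.GaloisRepresentations.SerreWeight
import HarnessLib

/-!
# A criterion for *peu ramifié*: upper ramification breaks `≤ 1` from a valuation bound

`Proofs` file (theorems only, no definitions, no named facts) in topic
`NumberTheory/GaloisRepresentations`, landed by the seat of
`Literature.NumberTheory.DiophantineGeometry.ribet1997_twoPowerFermat` (Ribet 1997 ⇐ Serre's
conjecture for the Frey curve `y² = x(x - a^p)(x + 2^α b^p)`), as the Galois-theoretic half of
Serre's statement *"si `E` a bonne réduction ordinaire en `p`, `ρ̄_{E,p}` est peu ramifiée"*
(Serre, Duke 54 (1987), §2.8, Prop. 3 and §4.2; the elliptic-curve half — the valuation of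
`σ x(P) - x(P)` for a `p`-torsion point `P` — is `OrdinaryReductionPeuRamifieProofs`).

Let `F` be a non-archimedean local field of characteristic `0` and residue characteristic `p`.

* `upperRamificationSubgroup_eq_bot_of_card_mul_le` — **Herbrand, abstract form**: for a finite
  group `G` acting on a ring `S` and an ideal `𝔓`, if `G_{s+1} = 1` and `s · #G_1 ≤ #G_0` then
  `φ(s) ≤ 1`, hence `G^u = G_{⌈ψ u⌉} ≤ G_{s+1} = 1` for every `u > 1`
  (Serre, *Local Fields*, IV §3: `φ(m) + 1 = (1/g₀) Σ_{i=0}^{m} gᵢ`, `ψ = φ⁻¹`).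
* `ramificationSubgroup_eq_bot_of_forall_exists_mul_pow_eq` — **finite level, lower numbering**:
  for a finite Galois `E/F` inside `F̄`, the prime `𝔓_E = 𝔓 ∩ E` and a uniformiser `ϖ` of `F`,
  if every `g ≠ 1` of the inertia group `G_0` admits `x, c ∈ 𝒪_E` with
  `c · (g x - x)^m = ϖ` (i.e. `v_F(g x - x) ≤ 1/m`), then `G_t = 1` as soon as
  `#G_0 = e(E/F) < (t + 1) m` (`v_E(g x - x) = e · v_F(g x - x) ≤ e/m < t + 1`).
* `upperRamificationSubgroup_eq_bot_of_forall_exists_mul_pow_eq` — the two combined with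
  `m = p - 1`, `#G_0 ≤ p (p - 1)` and "`G_1` is a `p`-group" (`#G_1 ≤ p`): `G^u = 1` for all
  `u > 1`.
* `ModPGaloisRep.isPeuRamifie_of_forall_exists_algNorm_le` — **the criterion**: a mod `p`
  representation `ρ : Γ_F → GL₂(k)` (discrete `k`) whose inertia image has at most `p (p - 1)`
  elements and such that every `τ ∈ I_F` with `ρ τ ≠ 1` moves some `ρ`-invariant integer `x` of
  `F̄` (`σ x = x` whenever `ρ σ = 1`) by at least `|ϖ|^{1/(p-1)}`, i.e.
  `|ϖ| ≤ |τ x - x|^{p-1}`, is *peu ramifiée*: `ρ(I_F^u) = 1` for `u > 1`.  (Applied in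
  `OrdinaryReductionPeuRamifieProofs` with `x = x(P)`, `P ∈ E[p] ∖ X_p`, at a place of good
  ordinary reduction of an elliptic curve over `ℚ`, `p ≥ 3`.)

## References

* [SerreLocalFields1979] J.-P. Serre, *Local Fields*, GTM 67 (1979), Ch. IV §1 (Lemma 1,
  Prop. 2 and Cor.: `e = #G_0`), §2 (Cor. 3 of Prop. 7: `G_1` is a `p`-group), §3 (p. 73:
  `φ(m) + 1 = (1/g₀) Σ gᵢ`; Prop. 14 and Remark 1: upper numbering of `Gal(F̄/F)`).
* [Serre1987] J.-P. Serre, *Sur les représentations modulaires de degré 2 de Gal(Q̄/Q)*,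
  Duke Math. J. 54 (1987), §2.4 (peu/très ramifié), §2.8 Prop. 3, §4.2.

## Design

Pure theorems.  The finite layer attached to `ρ` is the fixed field `E = F̄^{ker ρ}` of the open
kernel (`ArtinRestriction`: `finiteDimensional_fixedField_of_isOpen`,
`fixingSubgroup_fixedField_of_isOpen`, Mathlib `InfiniteGalois.normal_iff_isGalois`), on which
`Gal(E/F)` acts with `g = 1 ↔ ρ σ = 1` for any lift `σ`; `I_F ↠ G_0` and `I_F^u ↠ G^u` are the
tree's `absUpperInertia_map_absRestrictNormalHom_holds` (with `absUpperInertia_zero_holds`,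
`upperRamificationSubgroup_of_nonpos_holds`); `e = #G_0` is
`ramificationIdx'_under_base_eq_card_inertia`, `v_𝔓(ϖ) = e` is `ord_algebraMap`, and `G_1` is a
`p`-group by `isPGroup_ramificationSubgroup_one_of_isGalois`.
Axioms: `propext`, `Classical.choice`, `Quot.sound`.
-/

noncomputable section

open scoped Pointwise Valued
open Field ValuativeRel

namespace Literature.NumberTheory.GaloisRepresentations

universe u v

/-! ### §1 Herbrand: `G_{s+1} = 1` and `s · #G_1 ≤ #G_0` force `G^u = 1` for `u > 1` -/

section Herbrand

variable {S : Type*} [CommRing S] (𝔓 : Ideal S) (G : Type*) [Group G] [MulSemiringAction G S]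
  [Finite G]

/-- `g₀ (φ(s) + 1) = Σ_{i=0}^{s} gᵢ ≤ g₀ + s g₁`: the partial sums of the orders of the lower
ramification groups (`gᵢ ≤ g₁` for `i ≥ 1`).  Serre, *Local Fields*, IV §3, p. 73.
[cite: SerreLocalFields1979, Ch. IV §3 (p. 73)] -/
theorem sum_card_ramificationSubgroup_le (s : ℕ) :
    ∑ i ∈ Finset.range (s + 1), (Nat.card (𝔓.ramificationSubgroup G i) : ℝ) ≤
      Nat.card (𝔓.ramificationSubgroup G 0) + s * Nat.card (𝔓.ramificationSubgroup G 1) := by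
  rw [Finset.sum_range_succ']
  have h : ∀ i ∈ Finset.range s, Nat.card (𝔓.ramificationSubgroup G (i + 1)) ≤
      Nat.card (𝔓.ramificationSubgroup G 1) := fun i _ ↦
    Subgroup.card_le_of_le (𝔓.ramificationSubgroup_antitone G (Nat.le_add_left 1 i))
  calc ∑ i ∈ Finset.range s, (Nat.card (𝔓.ramificationSubgroup G (i + 1)) : ℝ) +
        Nat.card (𝔓.ramificationSubgroup G 0)
      ≤ ∑ _i ∈ Finset.range s, (Nat.card (𝔓.ramificationSubgroup G 1) : ℝ) +
        Nat.card (𝔓.ramificationSubgroup G 0) := by gcongr with i hi; exact h i hi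
    _ = Nat.card (𝔓.ramificationSubgroup G 0) + s * Nat.card (𝔓.ramificationSubgroup G 1) := by
        rw [Finset.sum_const, Finset.card_range, nsmul_eq_mul]; ring

/-- If `s · #G_1 ≤ #G_0` then `φ(s) ≤ 1`.  Serre, *Local Fields*, IV §3, p. 73
(`φ(m) + 1 = (1/g₀) Σ_{i=0}^{m} gᵢ`). [cite: SerreLocalFields1979, Ch. IV §3 (p. 73)] -/
theorem herbrandPhi_natCast_le_one_of_card_mul_le {s : ℕ}
    (hcard : s * Nat.card (𝔓.ramificationSubgroup G 1) ≤ Nat.card (𝔓.ramificationSubgroup G 0)) :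
    herbrandPhi 𝔓 G s ≤ 1 := by
  have h0 : (0 : ℝ) < Nat.card (𝔓.ramificationSubgroup G 0) := Nat.cast_pos.mpr Nat.card_pos
  have h := card_mul_herbrandPhi_natCast_add_one 𝔓 G s
  have hsum := sum_card_ramificationSubgroup_le 𝔓 G s
  have hc : (s : ℝ) * Nat.card (𝔓.ramificationSubgroup G 1) ≤
      Nat.card (𝔓.ramificationSubgroup G 0) := by exact_mod_cast hcard
  rw [← h] at hsum
  nlinarith

/-- **Upper breaks `≤ 1` from the lower filtration.**  If `G_{s+1} = 1` and `s · #G_1 ≤ #G_0`,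
then `G^u = 1` for every `u > 1`: indeed `φ(s) ≤ 1 < u` gives `ψ(u) > s`, so
`G^u = G_{⌈ψ u⌉} ≤ G_{s+1} = 1`.  Serre, *Local Fields*, IV §3 (pp. 73–74).
[cite: SerreLocalFields1979, Ch. IV §3 (pp. 73–74)] -/
theorem upperRamificationSubgroup_eq_bot_of_card_mul_le {s : ℕ}
    (hbot : 𝔓.ramificationSubgroup G (s + 1) = ⊥)
    (hcard : s * Nat.card (𝔓.ramificationSubgroup G 1) ≤ Nat.card (𝔓.ramificationSubgroup G 0))
    {u : ℝ} (hu : 1 < u) : upperRamificationSubgroup 𝔓 G u = ⊥ := by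
  have hφ := herbrandPhi_natCast_le_one_of_card_mul_le 𝔓 G hcard
  have hψ : (s : ℝ) < herbrandPsi 𝔓 G u := by
    by_contra hle
    rw [not_lt, herbrandPsi_le_iff] at hle
    linarith
  have hceil : s + 1 ≤ ⌈herbrandPsi 𝔓 G u⌉₊ := Nat.lt_ceil.mpr hψ
  rw [upperRamificationSubgroup, eq_bot_iff, ← hbot]
  exact 𝔓.ramificationSubgroup_antitone G hceil

omit [Finite G] in
/-- If `G_0 = 1` then `G^u = 1` for every `u` (`G^u ≤ G_0`). [folklore] -/
theorem upperRamificationSubgroup_eq_bot_of_inertia_eq_bot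
    (hbot : 𝔓.ramificationSubgroup G 0 = ⊥) (u : ℝ) : upperRamificationSubgroup 𝔓 G u = ⊥ := by
  rw [eq_bot_iff]
  intro g hg
  have h : g ∈ 𝔓.inertia G := upperRamificationSubgroup_le_inertia 𝔓 G u hg
  rwa [← Ideal.ramificationSubgroup_zero, hbot] at h

end Herbrand

/-! ### §2 Finite level over a local field: `G_t = 1` from `c (g x - x)^m = ϖ` -/

section FiniteLevel

open IsNonarchimedeanLocalField

variable (F : Type u) [Field F] [ValuativeRel F] [TopologicalSpace F] [IsNonarchimedeanLocalField F]

-- `𝔓_E = 𝔓 ∩ E ≠ ⊥` is `comap_absMaximalIdeal_ne_bot` (`TameInertiaCyclicProofs.lean`); the former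
-- `CharZero` restatement `comap_integralClosureToAbsIntegers_ne_bot` was removed as a duplicate
-- (dedup-02350, dedup-02614): use `comap_absMaximalIdeal_ne_bot F E`.

/-- **`G_t = 1` from a valuation bound on `g x - x` (finite level).**  Let `E/F` be finite Galois
inside `F̄`, `𝔓_E = 𝔓 ∩ E`, `ϖ` a uniformiser of `F`, `m ≥ 1`, and suppose every `g ≠ 1` in the
inertia group `G_0` of `𝔓_E` admits `x, c ∈ 𝒪_E` with `c · (g x - x)^m = ϖ`.  If
`#G_0 < (t + 1) m` then `G_t = 1`: for `g ∈ G_t`, `g x - x ∈ 𝔓_E^{t+1}`, so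
`ϖ ∈ 𝔓_E^{(t+1) m}`, contradicting `v_{𝔓_E}(ϖ) = e(𝔓_E ∣ 𝓂_F) = #G_0` (Serre, IV §1,
Lemma 1 and Cor. to Prop. 2).  [cite: SerreLocalFields1979, Ch. IV §1 Lemma 1, Prop. 2 Cor.] -/
theorem ramificationSubgroup_eq_bot_of_forall_exists_mul_pow_eq [CharZero F]
    (E : IntermediateField F (AlgebraicClosure F)) [FiniteDimensional F E] [IsGalois F E]
    {ϖ : 𝒪[F]} (hϖ : Irreducible ϖ) {m t : ℕ}
    (ht : Nat.card (((absMaximalIdeal F).comap (E.integralClosureToAbsIntegers 𝒪[F])).inertia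
      (E ≃ₐ[F] E)) < (t + 1) * m)
    (hval : ∀ g ∈ ((absMaximalIdeal F).comap (E.integralClosureToAbsIntegers 𝒪[F])).inertia
      (E ≃ₐ[F] E), g ≠ 1 → ∃ x c : integralClosure 𝒪[F] E,
        c * (g • x - x) ^ m = algebraMap 𝒪[F] (integralClosure 𝒪[F] E) ϖ) :
    ((absMaximalIdeal F).comap (E.integralClosureToAbsIntegers 𝒪[F])).ramificationSubgroup
      (E ≃ₐ[F] E) t = ⊥ := by
  classical
  set 𝔔 := (absMaximalIdeal F).comap (E.integralClosureToAbsIntegers 𝒪[F]) with h𝔔def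
  haveI : (absMaximalIdeal F).IsMaximal := absMaximalIdeal_isMaximal_holds F
  haveI : Finite (𝒪[F] ⧸ (absMaximalIdeal F).under 𝒪[F]) := finite_quotient_under_absMaximalIdeal F
  haveI h𝔔max : 𝔔.IsMaximal := isMaximal_comap_integralClosureToAbsIntegers 𝒪[F] (absMaximalIdeal F) E
  haveI := isSeparable_residue_comap 𝒪[F] (absMaximalIdeal F) E
  haveI : IsDedekindDomain (integralClosure 𝒪[F] E) :=
    IsIntegralClosure.isDedekindDomain 𝒪[F] F E (integralClosure 𝒪[F] E)
  have h𝔔0 : 𝔔 ≠ ⊥ := comap_absMaximalIdeal_ne_bot F E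
  -- `e = #G_0` and `v_𝔔(ϖ) = e`
  have he : (𝔔.under 𝒪[F]).ramificationIdx' 𝔔 = Nat.card (𝔔.inertia (E ≃ₐ[F] E)) :=
    ramificationIdx'_under_base_eq_card_inertia (K := F) 𝔔 h𝔔0
  have hunder : 𝔔.under 𝒪[F] = 𝓂[F] := by
    rw [h𝔔def, under_comap_integralClosureToAbsIntegers, under_absMaximalIdeal_holds F]
  have hordϖ : ord (𝔔.under 𝒪[F]) ϖ = 1 := by
    rw [hunder]
    exact ord_eq_one _ ((IsLocalRing.mem_maximalIdeal _).mpr hϖ.not_isUnit)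
      (not_mem_maximalIdeal_sq_of_irreducible hϖ)
  have hord : ord 𝔔 (algebraMap 𝒪[F] (integralClosure 𝒪[F] E) ϖ) =
      (Nat.card (𝔔.inertia (E ≃ₐ[F] E)) : ℕ∞) := by
    rw [ord_algebraMap (K := F) 𝔔 h𝔔0, hordϖ, mul_one, he]
  -- every `g ∈ G_t` is trivial
  rw [eq_bot_iff]
  intro g hg
  rw [Subgroup.mem_bot]
  by_contra hg1
  have hgI : g ∈ 𝔔.inertia (E ≃ₐ[F] E) := 𝔔.ramificationSubgroup_le_inertia _ t hg
  obtain ⟨x, c, hxc⟩ := hval g hgI hg1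
  have hy : g • x - x ∈ 𝔔 ^ (t + 1) := (Ideal.mem_ramificationSubgroup_iff.mp hg).2 x
  have hmem : algebraMap 𝒪[F] (integralClosure 𝒪[F] E) ϖ ∈ 𝔔 ^ ((t + 1) * m) := by
    rw [← hxc, pow_mul]
    exact Ideal.mul_mem_left _ c (Ideal.pow_mem_pow hy m)
  have hle := (mem_pow_iff_le_ord 𝔔).mp hmem
  rw [hord] at hle
  exact absurd (by exact_mod_cast hle : (t + 1) * m ≤ Nat.card (𝔔.inertia (E ≃ₐ[F] E)))
    (not_le.mpr ht)

/-- **Upper breaks `≤ 1` at a finite level** (`m = p - 1`).  Let `E/F` be finite Galois inside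
`F̄` with `F` of characteristic `0` and residue characteristic `p`, `𝔓_E = 𝔓 ∩ E`, `ϖ` a
uniformiser of `F`.  Suppose `#G_0 ≤ p (p - 1)` and every `g ≠ 1` in `G_0` admits `x, c ∈ 𝒪_E`
with `c (g x - x)^{p-1} = ϖ`.  Then `Gal(E/F)^u = 1` for every `u > 1`.
Proof: with `e = #G_0`, `t = ⌊e/(p-1)⌋`, the previous lemma gives `G_t = 1`; `G_1` is a
`p`-group of order `≤ e < p²`, so `#G_1 ≤ p` and `(t - 1) #G_1 ≤ (t - 1) p ≤ e` (as
`t ≤ p`); conclude by `upperRamificationSubgroup_eq_bot_of_card_mul_le`.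
Serre, Duke 54 (1987), §2.8 (proof of Prop. 3: the jumps of `ρ̄|I` are `≤ 1`).
[cite: Serre1987, §2.8 Prop. 3] [cite: SerreLocalFields1979, Ch. IV §§1–3] -/
theorem upperRamificationSubgroup_eq_bot_of_forall_exists_mul_pow_eq [CharZero F]
    (E : IntermediateField F (AlgebraicClosure F)) [FiniteDimensional F E] [IsGalois F E]
    {p : ℕ} [hp : Fact p.Prime] (hpchar : ringChar 𝓀[F] = p) {ϖ : 𝒪[F]} (hϖ : Irreducible ϖ)
    (hcard : Nat.card (((absMaximalIdeal F).comap (E.integralClosureToAbsIntegers 𝒪[F])).inertia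
      (E ≃ₐ[F] E)) ≤ p * (p - 1))
    (hval : ∀ g ∈ ((absMaximalIdeal F).comap (E.integralClosureToAbsIntegers 𝒪[F])).inertia
      (E ≃ₐ[F] E), g ≠ 1 → ∃ x c : integralClosure 𝒪[F] E,
        c * (g • x - x) ^ (p - 1) = algebraMap 𝒪[F] (integralClosure 𝒪[F] E) ϖ)
    {u : ℝ} (hu : 1 < u) :
    upperRamificationSubgroup ((absMaximalIdeal F).comap (E.integralClosureToAbsIntegers 𝒪[F]))
      (E ≃ₐ[F] E) u = ⊥ := by
  classical
  set 𝔔 := (absMaximalIdeal F).comap (E.integralClosureToAbsIntegers 𝒪[F]) with h𝔔def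
  set G := E ≃ₐ[F] E
  have hp2 : 2 ≤ p := hp.out.two_le
  obtain ⟨q, hq⟩ : ∃ q, p = q + 1 := ⟨p - 1, by omega⟩
  have hq1 : p - 1 = q := by omega
  have hqpos : 0 < q := by omega
  set e := Nat.card (𝔔.inertia G) with hedef
  -- `t = ⌊e / (p - 1)⌋`, `e < (t + 1)(p - 1)`, `t (p - 1) ≤ e`
  obtain ⟨t, htdef⟩ : ∃ t, t = e / q := ⟨_, rfl⟩
  have ht : e < (t + 1) * q := by
    have := Nat.lt_div_mul_add (a := e) hqpos
    rw [add_mul, one_mul, htdef]; exact this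
  have htle : t * q ≤ e := htdef ▸ Nat.div_mul_le_self e q
  have hGt : 𝔔.ramificationSubgroup G t = ⊥ :=
    ramificationSubgroup_eq_bot_of_forall_exists_mul_pow_eq F E hϖ (m := q) (t := t) ht
      (by rw [← hq1]; exact hval)
  rcases Nat.eq_zero_or_pos t with ht0 | htpos
  · -- `t = 0`: `G_0 = 1`
    rw [ht0] at hGt
    exact upperRamificationSubgroup_eq_bot_of_inertia_eq_bot 𝔔 G hGt u
  obtain ⟨s, rfl⟩ : ∃ s, t = s + 1 := ⟨t - 1, by omega⟩
  -- `#G_1 ≤ p`: a `p`-group of order `≤ e ≤ p (p - 1) < p²`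
  have hG1le : Nat.card (𝔔.ramificationSubgroup G 1) ≤ e := by
    rw [hedef, ← Ideal.ramificationSubgroup_zero]
    exact Subgroup.card_le_of_le (𝔔.ramificationSubgroup_antitone G zero_le_one)
  have hG1 : Nat.card (𝔔.ramificationSubgroup G 1) ≤ p := by
    have hP : IsPGroup p (𝔔.ramificationSubgroup G 1) := by
      have := isPGroup_ramificationSubgroup_one_of_isGalois (F := F) E
      rwa [hpchar] at this
    obtain ⟨n, hn⟩ := hP.exists_card_eq
    rw [hn] at hG1le ⊢
    have hlt : p ^ n < p ^ 2 := by
      calc p ^ n ≤ e := hG1le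
        _ ≤ p * (p - 1) := hcard
        _ < p ^ 2 := by
          rw [sq]; exact Nat.mul_lt_mul_of_pos_left (by omega) hp.out.pos
    have hn1 : n ≤ 1 := by
      have := (Nat.pow_lt_pow_iff_right (by omega : 1 < p)).mp hlt
      omega
    calc p ^ n ≤ p ^ 1 := Nat.pow_le_pow_right hp.out.pos hn1
      _ = p := pow_one p
  -- `s #G_1 ≤ e`
  have hs : s + 1 ≤ p := by
    have h1 : (s + 1) * q ≤ p * q := htle.trans (by rw [← hq1]; exact hcard)
    exact Nat.le_of_mul_le_mul_right h1 hqpos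
  have hcard' : s * Nat.card (𝔔.ramificationSubgroup G 1) ≤ Nat.card (𝔔.ramificationSubgroup G 0) := by
    rw [Ideal.ramificationSubgroup_zero, ← hedef]
    calc s * Nat.card (𝔔.ramificationSubgroup G 1) ≤ s * p := Nat.mul_le_mul_left s hG1
      _ = s * q + s := by rw [hq]; ring
      _ ≤ s * q + q := by omega
      _ = (s + 1) * q := by ring
      _ ≤ e := htle
  exact upperRamificationSubgroup_eq_bot_of_card_mul_le 𝔔 G hGt hcard' hu

end FiniteLevel

/-! ### §3 The criterion for `ρ : Γ_F → GL₂(k)` -/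

namespace ModPGaloisRep

open IsNonarchimedeanLocalField

variable {F : Type u} [Field F] [ValuativeRel F] [TopologicalSpace F] [IsNonarchimedeanLocalField F]
  {k : Type v} [Field k] [TopologicalSpace k] [DiscreteTopology k] {n : ℕ}

omit [ValuativeRel F] [TopologicalSpace F] [IsNonarchimedeanLocalField F] in
/-- The kernel of a mod `p` Galois representation with discrete coefficients is open.
[folklore] -/
theorem isOpen_ker (ρ : ModPGaloisRep F k n) :
    IsOpen (ρ.toMonoidHom.ker : Set (absoluteGaloisGroup F)) := by
  have : (ρ.toMonoidHom.ker : Set (absoluteGaloisGroup F)) = ρ ⁻¹' {1} := by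
    ext; simp [MonoidHom.mem_ker]
  rw [this]
  exact (isOpen_discrete _).preimage ρ.continuous_toFun

/-- **Criterion for *peu ramifié*** (Serre, Duke 54 (1987), §2.4 and §2.8, Prop. 3, Galois side).
Let `F` be a non-archimedean local field of characteristic `0` with residue characteristic `p`
and uniformiser `ϖ`, and `ρ : Γ_F → GL_n(k)` a continuous representation over a discrete field
`k` such that
* the image of inertia `ρ(I_F)` has at most `p (p - 1)` elements, and
* every `τ ∈ I_F` with `ρ τ ≠ 1` moves some integer `x ∈ 𝒪_{F̄}` fixed by `ker ρ` by at least
  `|ϖ|^{1/(p-1)}`: `|ϖ| ≤ |τ x - x|^{p-1}`.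
Then `ρ` is *peu ramifiée*: `ρ(I_F^u) = 1` for every `u > 1`.
Proof: on the finite Galois layer `E = F̄^{ker ρ}` the hypotheses say `#G_0 ≤ p (p - 1)` and
`c (g x - x)^{p-1} = ϖ` in `𝒪_E` for every `g ≠ 1` in `G_0` (`c = ϖ / (τ x - x)^{p-1}` is an
integer of `E`), so `Gal(E/F)^u = 1` for `u > 1`
(`upperRamificationSubgroup_eq_bot_of_forall_exists_mul_pow_eq`), and `I_F^u` maps into
`Gal(E/F)^u`.  [cite: Serre1987, §2.4, §2.8 Prop. 3]
[cite: SerreLocalFields1979, Ch. IV §3 Prop. 14 and Remark 1] -/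
theorem isPeuRamifie_of_forall_exists_algNorm_le [CharZero F] (ρ : ModPGaloisRep F k n)
    {p : ℕ} [hp : Fact p.Prime] (hpchar : ringChar 𝓀[F] = p) {ϖ : 𝒪[F]} (hϖ : Irreducible ϖ)
    (hcard : Nat.card ((absInertia F).map ρ.toMonoidHom) ≤ p * (p - 1))
    (hval : ∀ τ ∈ absInertia F, ρ τ ≠ 1 → ∃ x : AlgebraicClosure F,
      (∀ σ : absoluteGaloisGroup F, ρ σ = 1 → σ • x = x) ∧ algNorm F x ≤ 1 ∧
        algNorm F (algebraMap 𝒪[F] (AlgebraicClosure F) ϖ) ≤ algNorm F (τ • x - x) ^ (p - 1)) :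
    ρ.IsPeuRamifie := by
  classical
  -- the finite Galois layer `E = F̄^{ker ρ}`
  set N : Subgroup (absoluteGaloisGroup F) := ρ.toMonoidHom.ker with hNdef
  have hNopen : IsOpen (N : Set (absoluteGaloisGroup F)) := isOpen_ker ρ
  set E : IntermediateField F (AlgebraicClosure F) := IntermediateField.fixedField N with hEdef
  have hEN : E.fixingSubgroup = N := fixingSubgroup_fixedField_of_isOpen N hNopen
  haveI : FiniteDimensional F E := finiteDimensional_fixedField_of_isOpen N hNopen
  haveI : IsGalois F E := by
    rw [← InfiniteGalois.normal_iff_isGalois, hEN, hNdef]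
    exact MonoidHom.normal_ker _
  set G := E ≃ₐ[F] E with hGdef
  set res : absoluteGaloisGroup F →* G := absRestrictNormalHom E with hresdef
  -- `res σ = 1 ↔ ρ σ = 1`
  have hker : ∀ σ : absoluteGaloisGroup F, res σ = 1 ↔ ρ σ = 1 := by
    intro σ
    have h1 : res σ = 1 ↔ absoluteGaloisGroup.toAlgEquiv F σ ∈ E.fixingSubgroup := by
      rw [← IntermediateField.restrictNormalHom_ker, MonoidHom.mem_ker]; rfl
    rw [h1, hEN, hNdef]
    show σ ∈ ρ.toMonoidHom.ker ↔ _
    rw [MonoidHom.mem_ker]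
    rfl
  have hres_eq : ∀ σ σ' : absoluteGaloisGroup F, res σ = res σ' ↔ ρ σ = ρ σ' := by
    intro σ σ'
    rw [← inv_mul_eq_one, ← map_inv, ← map_mul, hker, map_mul, map_inv, inv_mul_eq_one]
  -- the prime `𝔔 = 𝔓 ∩ E`, its inertia group `G_0 = res(I_F)`
  set 𝔔 := (absMaximalIdeal F).comap (E.integralClosureToAbsIntegers 𝒪[F]) with h𝔔def
  have hI : 𝔔.inertia G = (absInertia F).map res := by
    have h := absUpperInertia_map_absRestrictNormalHom_holds (F := F) E 0 le_rfl
    rw [absUpperInertia_zero_holds F] at h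
    rw [← upperRamificationSubgroup_of_nonpos_holds 𝔔 G (v := 0) le_rfl]
    exact h.symm
  -- `#G_0 = #ρ(I_F) ≤ p (p - 1)`
  have hcardG : Nat.card (𝔔.inertia G) ≤ p * (p - 1) := by
    rw [hI]
    refine le_trans (le_of_eq ?_) hcard
    have hlift : ∀ g : (absInertia F).map res, ∃ τ ∈ absInertia F, res τ = g := fun g ↦
      Subgroup.mem_map.mp g.2
    choose lift hliftI hlift_eq using hlift
    let f : (absInertia F).map res → (absInertia F).map ρ.toMonoidHom := fun g ↦
      ⟨ρ (lift g), Subgroup.mem_map.mpr ⟨lift g, hliftI g, rfl⟩⟩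
    have hf_inj : Function.Injective f := by
      intro g g' hgg'
      have h3 : ρ (lift g) = ρ (lift g') := congrArg Subtype.val hgg'
      rw [← hres_eq, hlift_eq, hlift_eq] at h3
      exact Subtype.ext h3
    have hf_surj : Function.Surjective f := by
      rintro ⟨y, hy⟩
      obtain ⟨τ, hτ, rfl⟩ := Subgroup.mem_map.mp hy
      refine ⟨⟨res τ, Subgroup.mem_map.mpr ⟨τ, hτ, rfl⟩⟩, Subtype.ext ?_⟩
      have h4 : res (lift ⟨res τ, Subgroup.mem_map.mpr ⟨τ, hτ, rfl⟩⟩) = res τ := hlift_eq _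
      rw [hres_eq] at h4
      exact h4
    exact Nat.card_congr (Equiv.ofBijective f ⟨hf_inj, hf_surj⟩)
  -- the witnesses at level `E`
  have hinj : Function.Injective ((E.val).restrictScalars 𝒪[F]) := fun a b h ↦ Subtype.ext h
  have hmemE : ∀ {x : AlgebraicClosure F}, (∀ σ : absoluteGaloisGroup F, ρ σ = 1 → σ • x = x) →
      x ∈ E := by
    intro x hx
    rw [hEdef, IntermediateField.mem_fixedField_iff]
    intro σ hσ
    exact hx σ (MonoidHom.mem_ker.mp hσ)
  have hvalE : ∀ g ∈ 𝔔.inertia G, g ≠ 1 → ∃ x c : integralClosure 𝒪[F] E,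
      c * (g • x - x) ^ (p - 1) = algebraMap 𝒪[F] (integralClosure 𝒪[F] E) ϖ := by
    intro g hg hg1
    rw [hI] at hg
    obtain ⟨τ, hτ, rfl⟩ := Subgroup.mem_map.mp hg
    have hρτ : ρ τ ≠ 1 := fun h ↦ hg1 ((hker τ).mpr h)
    obtain ⟨x, hxfix, hxint, hxval⟩ := hval τ hτ hρτ
    have hϖF : algebraMap 𝒪[F] (AlgebraicClosure F) ϖ ≠ 0 := by
      intro h
      apply hϖ.ne_zero
      have hinjOF : Function.Injective (algebraMap 𝒪[F] (AlgebraicClosure F)) := by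
        rw [IsScalarTower.algebraMap_eq 𝒪[F] F (AlgebraicClosure F)]
        exact (algebraMap F (AlgebraicClosure F)).injective.comp (IsFractionRing.injective 𝒪[F] F)
      exact hinjOF (by rw [h, map_zero])
    have hϖ0 : 0 < algNorm F (algebraMap 𝒪[F] (AlgebraicClosure F) ϖ) := algNorm_pos_iff.mpr hϖF
    set y : AlgebraicClosure F := τ • x - x with hydef
    have hy0 : y ≠ 0 := by
      intro h
      rw [h, algNorm_zero, zero_pow (by have := hp.out.two_le; omega)] at hxval
      exact absurd hxval (not_le.mpr hϖ0)
    have hypos : 0 < algNorm F y ^ (p - 1) := pow_pos (algNorm_pos_iff.mpr hy0) _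
    -- `x`, `τ x` and `c = ϖ / y^{p-1}` lie in `E` and are integral
    have hxE : x ∈ E := hmemE hxfix
    have hτxE : τ • x ∈ E := by
      refine hmemE fun σ hσ ↦ ?_
      have h' : ρ (τ⁻¹ * σ * τ) = 1 := by
        rw [map_mul, map_mul, hσ, mul_one, ← map_mul, inv_mul_cancel, map_one]
      have := hxfix _ h'
      rw [mul_smul, mul_smul, inv_smul_eq_iff] at this
      exact this
    set c : AlgebraicClosure F := algebraMap 𝒪[F] (AlgebraicClosure F) ϖ / y ^ (p - 1) with hcdef
    have hcE : c ∈ E := div_mem (by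
        rw [IsScalarTower.algebraMap_apply 𝒪[F] F (AlgebraicClosure F)]
        exact E.algebraMap_mem _) (pow_mem (sub_mem hτxE hxE) _)
    have hcint : algNorm F c ≤ 1 := by
      rw [hcdef, algNorm_div, algNorm_pow, div_le_one hypos]
      exact hxval
    have hτxint : algNorm F (τ • x) ≤ 1 := by rwa [algNorm_smul]
    -- as elements of `𝒪_E`
    have mk : ∀ {z : AlgebraicClosure F}, z ∈ E → algNorm F z ≤ 1 →
        ∃ zE : integralClosure 𝒪[F] E, ((zE : E) : AlgebraicClosure F) = z := by
      intro z hzE hz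
      have hzint : IsIntegral 𝒪[F] z := mem_absIntegers_iff_algNorm_le_one.mpr hz
      refine ⟨⟨⟨z, hzE⟩, ?_⟩, rfl⟩
      exact (isIntegral_algHom_iff ((E.val).restrictScalars 𝒪[F]) hinj).mp hzint
    obtain ⟨xE, hxE'⟩ := mk hxE hxint
    obtain ⟨cE, hcE'⟩ := mk hcE hcint
    refine ⟨xE, cE, ?_⟩
    -- check the identity in `F̄`
    apply E.integralClosureInclusion_injective 𝒪[F]
    apply Subtype.ext
    have hgx : ((E.integralClosureToAbsIntegers 𝒪[F] (res τ • xE) : absIntegers 𝒪[F] F) :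
        AlgebraicClosure F) = τ • x := by
      rw [hresdef]
      change ((E.integralClosureToAbsIntegers 𝒪[F]
        (AlgEquiv.restrictNormalHom E (absoluteGaloisGroup.toAlgEquiv F τ) • xE) :
          absIntegers 𝒪[F] F) : AlgebraicClosure F) = τ • x
      rw [E.integralClosureToAbsIntegers_restrictNormalHom_smul 𝒪[F] τ xE, ← hxE']
      rfl
    have hιx : ((E.integralClosureToAbsIntegers 𝒪[F] xE : absIntegers 𝒪[F] F) :
        AlgebraicClosure F) = x := by rw [← hxE']; rfl
    have hιc : ((E.integralClosureToAbsIntegers 𝒪[F] cE : absIntegers 𝒪[F] F) :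
        AlgebraicClosure F) = c := by rw [← hcE']; rfl
    rw [map_mul, map_pow, map_sub]
    change ((E.integralClosureToAbsIntegers 𝒪[F] cE : absIntegers 𝒪[F] F) : AlgebraicClosure F) *
      (((E.integralClosureToAbsIntegers 𝒪[F] (res τ • xE) : absIntegers 𝒪[F] F) :
          AlgebraicClosure F) -
        ((E.integralClosureToAbsIntegers 𝒪[F] xE : absIntegers 𝒪[F] F) : AlgebraicClosure F)) ^
        (p - 1) = ((E.integralClosureToAbsIntegers 𝒪[F] (algebraMap 𝒪[F] _ ϖ) :
          absIntegers 𝒪[F] F) : AlgebraicClosure F)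
    rw [hgx, hιx, hιc, AlgHom.commutes, hcdef, ← hydef, div_mul_cancel₀ _ (pow_ne_zero _ hy0)]
    rfl
  -- conclusion
  intro u hu σ hσ
  have hmem : res σ ∈ upperRamificationSubgroup 𝔔 G u := mem_absUpperRamificationSubgroup_iff.mp hσ E
  rw [upperRamificationSubgroup_eq_bot_of_forall_exists_mul_pow_eq F E hpchar hϖ hcardG hvalE hu,
    Subgroup.mem_bot] at hmem
  exact (hker σ).mp hmem

end ModPGaloisRep

end Literature.NumberTheory.GaloisRepresentations
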